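import Summits.AtomisticToContinuum.Crystallization.Theorems.ChartedPlanarOrderNashForceBalanceLayers

/-!
# Counting and comparison tools on separated layered door sets (decomp-a2c lens-3 g23; D1s `StraddleSummable`, part 1/2)

Blocker `N = ChartedPlanarOrder.ChartedZeroExcessLayered`, PS column, node D1s `…ProfileSlavingLJBalance.StraddleSummable Λ`
(critic row 435 (1)): the layer-pair forces `pairFamily a b w (k, l) = layerForce a b (w k − w l)` are summable over every straddle set
`{k < m ≤ l}`.  This module holds the configuration-free tools of the proof (part 2 is `…ChartedPlanarOrderStraddleSummable`):

* §1 `summable_comp_of_fibre` — the FIBRE COMPARISON: `F ∘ G` is summable as soon as the finite subsets of the fibres of `G` have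
  `≤ c y` elements and `∑ c·F < ∞`; `summable_inv_cube_add` — `∑_{d,j ≥ 0} (1+d+j)⁻³ < ∞` (fibres of `(d,j) ↦ d+j`).
* §2 `exists_unit_normal`, `exists_onb` — a stacked profile has a unit normal `ν`, and `ν` extends to an orthonormal frame `e` of `E3`
  (`Orthonormal.exists_orthonormalBasis_extension_of_card_eq`).
* §3 `gridE` — the grid map in the ROTATED frame `e` (integer parts of `(2/δ)⟪e i, ·⟫`), injective on `δ`-separated sets
  (`gridE_injOn`, as `…NashForceBalance.grid_injOn` with `‖v‖² = ∑ ⟪e i, v⟫²`).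
* §4 the ANISOTROPIC comparison weight `W3 k₀ k = c(k₁−k₀₁)·b(k₂−k₀₂)·b(k₃−k₀₃)`, `c k = (1+|k|)⁻³`, `b k = (1+|k|)⁻²` (cubic decay along
  the normal axis `e 0`, quadratic along the other two: integer exponents `3+2+2 = 7`), and the termwise DOMINATION for `‖p − q‖ ≥ δ`:
  `‖p−q‖⁻⁷ ≤ (4/δ)⁷ W3 (gridE p) (gridE q)` (`inv_pow_seven_le_W3`), hence ★ `‖pairForce (p − q)‖ ≤ (δ⁻⁶+1)(4/δ)⁷ W3 (gridE p) (gridE q)`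
  (`norm_pairForce_le_W3`, from `…NashForceBalance.norm_pairForce_le`: `|V'_LJ(r)| r… ≤ r⁻¹³ + r⁻⁷ ≤ (δ⁻⁶+1) r⁻⁷`); the straddle
  comparison weight `FWeight ((d,j),(x,y)) = (1+d+j)⁻³ b x b y` is summable (`summable_FWeight`).
* §5 ★ `card_le_of_sep` — BALL COUNT: at most `(4R/δ+2)³` atoms of a `δ`-separated set lie in a ball of radius `R`
  (grid injection into a box, `Finset.card_le_card_of_injOn`).

Mathlib only (+ the lens-3 modules imported); `[folklore]`; no instances, no notation, sorry-free.
-/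

noncomputable section

open MeasureTheory Set Metric Filter Topology
open scoped RealInnerProductSpace
open Summit.AtomisticToContinuum.Crystallization.Theorems.ChartedPlanarOrderRigidityDoor
open Summit.AtomisticToContinuum.Crystallization.Theorems.ChartedPlanarOrderDensityDichotomy
open Summit.AtomisticToContinuum.Crystallization.Theorems.ChartedPlanarOrderMesoCut
open Summit.AtomisticToContinuum.Crystallization.Theorems.ChartedPlanarOrderProfileSlavingLJ (pairForce layerForce IsStacked)
open Summit.AtomisticToContinuum.Crystallization.Theorems.ChartedPlanarOrderDoorLayered (Layered)
open Summit.AtomisticToContinuum.Crystallization.Theorems.ChartedPlanarOrderNashForceBalance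

namespace Summit.AtomisticToContinuum.Crystallization.Theorems.ChartedPlanarOrderSepCounting

/-! ## 1. Fibre comparison and the series `∑ (1+d+j)⁻³` -/

section Fibre

/-- ★ **fibre comparison**: if every finite subset of each fibre `G⁻¹(y)` has at most `c y` elements and `∑ c y · F y < ∞`
(`F ≥ 0`), then `F ∘ G` is summable. -/
theorem summable_comp_of_fibre {ι κ : Type*} (G : ι → κ) {F c : κ → ℝ} (hF : ∀ y, 0 ≤ F y)
    (hs : Summable fun y => c y * F y)
    (hfib : ∀ (y : κ) (s : Finset ι), (∀ i ∈ s, G i = y) → (s.card : ℝ) ≤ c y) :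
    Summable (F ∘ G) := by
  classical
  have hc : ∀ y, 0 ≤ c y := fun y => by simpa using hfib y ∅ (by simp)
  refine summable_of_sum_le (c := ∑' y, c y * F y) (fun i => hF (G i)) (fun s => ?_)
  show ∑ i ∈ s, F (G i) ≤ ∑' y, c y * F y
  calc ∑ i ∈ s, F (G i) = ∑ y ∈ s.image G, ∑ i ∈ s with G i = y, F (G i) :=
        (Finset.sum_fiberwise_of_maps_to (fun i hi => Finset.mem_image_of_mem G hi) _).symm
    _ ≤ ∑ y ∈ s.image G, c y * F y := by
        refine Finset.sum_le_sum fun y _ => ?_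
        have h1 : ∑ i ∈ s with G i = y, F (G i) = ((s.filter fun i => G i = y).card : ℝ) * F y := by
          rw [Finset.sum_congr rfl fun i hi => by rw [(Finset.mem_filter.mp hi).2], Finset.sum_const, nsmul_eq_mul]
        rw [h1]
        exact mul_le_mul_of_nonneg_right (hfib y _ fun i hi => (Finset.mem_filter.mp hi).2) (hF y)
    _ ≤ ∑' y, c y * F y := hs.sum_le_tsum _ fun y _ => mul_nonneg (hc y) (hF y)

/-- `(1+n)⁻³ ≥ 0`. -/
theorem inv_cube_nonneg (n : ℕ) : (0 : ℝ) ≤ ((1 + (n : ℝ)) ^ 3)⁻¹ := by positivity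

/-- `(1+d+j)⁻³ ≥ 0`. -/
theorem inv_cube_add_nonneg (p : ℕ × ℕ) : (0 : ℝ) ≤ ((1 + (p.1 : ℝ) + p.2) ^ 3)⁻¹ := by positivity

/-- ★ `∑_{d, j ≥ 0} (1 + d + j)⁻³ < ∞`: the fibre of `(d, j) ↦ d + j` over `n` has `n + 1` elements and `∑ (n+1)(1+n)⁻³ = ∑ (1+n)⁻² < ∞`. -/
theorem summable_inv_cube_add : Summable fun p : ℕ × ℕ => ((1 + (p.1 : ℝ) + p.2) ^ 3)⁻¹ := by
  have hs : Summable fun n : ℕ => ((n : ℝ) + 1) * ((1 + (n : ℝ)) ^ 3)⁻¹ := by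
    have h2 : Summable fun n : ℕ => (((n + 1 : ℕ) : ℝ) ^ 2)⁻¹ :=
      (summable_nat_add_iff (f := fun n : ℕ => ((n : ℝ) ^ 2)⁻¹) 1).mpr (Real.summable_nat_pow_inv.mpr one_lt_two)
    refine h2.congr fun n => ?_
    push_cast
    have : (0 : ℝ) < 1 + n := by positivity
    field_simp
    ring
  have h := summable_comp_of_fibre (fun p : ℕ × ℕ => p.1 + p.2) (F := fun n : ℕ => ((1 + (n : ℝ)) ^ 3)⁻¹)
    (c := fun n : ℕ => (n : ℝ) + 1) inv_cube_nonneg hs ?_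
  · refine h.congr fun p => ?_
    simp only [Function.comp_apply, Nat.cast_add, add_assoc]
  · intro n s hs'
    have hsub : s ⊆ Finset.HasAntidiagonal.antidiagonal n := fun p hp =>
      Finset.HasAntidiagonal.mem_antidiagonal.mpr (hs' p hp)
    have := Finset.card_le_card hsub
    rw [Finset.Nat.card_antidiagonal] at this
    exact_mod_cast this

end Fibre


/-! ## 2. Unit normal of a stacked profile; an orthonormal frame containing it -/

section Frame

/-- a stacked profile has a UNIT normal: orthogonal to both periods, heights strictly increasing. -/
theorem exists_unit_normal {a b : E3} {w : ℤ → E3} (hst : IsStacked a b w) :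
    ∃ ν : E3, ‖ν‖ = 1 ∧ ⟪ν, a⟫ = 0 ∧ ⟪ν, b⟫ = 0 ∧ ∀ m : ℤ, 0 < ⟪ν, w (m + 1) - w m⟫ := by
  obtain ⟨n, hna, hnb, hn⟩ := hst
  have hn0 : n ≠ 0 := by
    intro h
    have := hn 0
    rw [h, inner_zero_left] at this
    exact lt_irrefl _ this
  have hnorm : 0 < ‖n‖ := norm_pos_iff.mpr hn0
  refine ⟨‖n‖⁻¹ • n, ?_, ?_, ?_, fun m => ?_⟩
  · rw [norm_smul, norm_inv, norm_norm, inv_mul_cancel₀ hnorm.ne']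
  · rw [real_inner_smul_left, hna, mul_zero]
  · rw [real_inner_smul_left, hnb, mul_zero]
  · rw [real_inner_smul_left]
    exact mul_pos (inv_pos.mpr hnorm) (hn m)

/-- an orthonormal frame of `E3` whose first vector is a given unit vector. -/
theorem exists_onb {ν : E3} (hν : ‖ν‖ = 1) : ∃ e : OrthonormalBasis (Fin 3) ℝ E3, e 0 = ν := by
  have hv : Orthonormal ℝ (({0} : Set (Fin 3)).restrict fun _ : Fin 3 => ν) := by
    rw [orthonormal_iff_ite]
    rintro ⟨i, hi⟩ ⟨j, hj⟩
    rw [Set.mem_singleton_iff] at hi hj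
    subst hi
    subst hj
    simp [hν]
  obtain ⟨e, he⟩ := Orthonormal.exists_orthonormalBasis_extension_of_card_eq (𝕜 := ℝ) (E := E3)
    (by rw [Fintype.card_fin]; exact finrank_euclideanSpace_fin) hv
  exact ⟨e, he 0 (Set.mem_singleton _)⟩

/-- `‖v‖²` is the sum of the three squared frame coordinates. -/
theorem norm_sq_eq_sum_inner (e : OrthonormalBasis (Fin 3) ℝ E3) (v : E3) :
    ‖v‖ ^ 2 = ⟪e 0, v⟫ ^ 2 + ⟪e 1, v⟫ ^ 2 + ⟪e 2, v⟫ ^ 2 := by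
  rw [← e.sum_sq_inner_right v, Fin.sum_univ_three]

/-- a frame-coordinate difference is bounded by the norm of the difference. -/
theorem abs_inner_sub_le (e : OrthonormalBasis (Fin 3) ℝ E3) (v w : E3) (i : Fin 3) :
    |⟪e i, v⟫ - ⟪e i, w⟫| ≤ ‖v - w‖ := by
  rw [← inner_sub_right]
  have h := abs_real_inner_le_norm (e i) (v - w)
  rwa [e.norm_eq_one, one_mul] at h

end Frame


/-! ## 3. The rotated grid map -/

section Grid

variable {δ : ℝ} {S : Set E3}

/-- the rotated grid map: integer parts, at scale `δ/2`, of the coordinates in the orthonormal frame `e`. -/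
def gridE (δ : ℝ) (e : OrthonormalBasis (Fin 3) ℝ E3) (q : E3) : ℤ × ℤ × ℤ :=
  (⌊2 / δ * ⟪e 0, q⟫⌋, ⌊2 / δ * ⟪e 1, q⟫⌋, ⌊2 / δ * ⟪e 2, q⟫⌋)

/-- the first grid coordinate is the integer part of `(2/δ) ⟪e 0, q⟫`. -/
theorem gridE_fst (e : OrthonormalBasis (Fin 3) ℝ E3) (q : E3) : (gridE δ e q).1 = ⌊2 / δ * ⟪e 0, q⟫⌋ := rfl

/-- ★ the rotated grid map is injective on a `δ`-separated set. -/
theorem gridE_injOn (hδ : 0 < δ) (e : OrthonormalBasis (Fin 3) ℝ E3) (hS : IsSep δ S) : Set.InjOn (gridE δ e) S := by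
  intro q hq q' hq' h
  simp only [gridE, Prod.mk.injEq] at h
  obtain ⟨h0, h1, h2⟩ := h
  have e0 := abs_sub_lt_of_floor_eq hδ h0
  have e1 := abs_sub_lt_of_floor_eq hδ h1
  have e2 := abs_sub_lt_of_floor_eq hδ h2
  by_contra hne
  have hd : δ ≤ ‖q - q'‖ := by rw [← dist_eq_norm]; exact hS q hq q' hq' hne
  have hsq := norm_sq_eq_sum_inner e (q - q')
  rw [inner_sub_right, inner_sub_right, inner_sub_right] at hsq
  have a0 : (⟪e 0, q⟫ - ⟪e 0, q'⟫) ^ 2 < (δ / 2) ^ 2 := sq_lt_sq' (abs_lt.mp e0).1 (abs_lt.mp e0).2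
  have a1 : (⟪e 1, q⟫ - ⟪e 1, q'⟫) ^ 2 < (δ / 2) ^ 2 := sq_lt_sq' (abs_lt.mp e1).1 (abs_lt.mp e1).2
  have a2 : (⟪e 2, q⟫ - ⟪e 2, q'⟫) ^ 2 < (δ / 2) ^ 2 := sq_lt_sq' (abs_lt.mp e2).1 (abs_lt.mp e2).2
  have hδ2 : δ ^ 2 ≤ ‖q - q'‖ ^ 2 := pow_le_pow_left₀ hδ.le hd 2
  nlinarith

end Grid


/-! ## 4. The anisotropic comparison weight and the pair-force domination -/

section Weight

variable {δ : ℝ}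

/-- the comparison weight on `ℤ` with cubic decay: `c k = (1 + |k|)⁻³`. -/
def cWeight (k : ℤ) : ℝ := ((1 + |(k : ℝ)|) ^ 3)⁻¹

/-- `c k ≥ 0`. -/
theorem cWeight_nonneg (k : ℤ) : 0 ≤ cWeight k := by unfold cWeight; positivity

/-- the anisotropic comparison weight on `ℤ³`: cubic decay along the first (normal) axis, quadratic along the other two. -/
def W3 (k₀ k : ℤ × ℤ × ℤ) : ℝ := cWeight (k.1 - k₀.1) * (bWeight (k.2.1 - k₀.2.1) * bWeight (k.2.2 - k₀.2.2))

/-- `W3 ≥ 0`. -/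
theorem W3_nonneg (k₀ k : ℤ × ℤ × ℤ) : 0 ≤ W3 k₀ k :=
  mul_nonneg (cWeight_nonneg _) (mul_nonneg (bWeight_nonneg _) (bWeight_nonneg _))

/-- ★ the termwise comparison `‖p − q‖⁻⁷ ≤ (4/δ)⁷ · W3 (gridE p) (gridE q)` for `‖p − q‖ ≥ δ` (exponents `3 + 2 + 2`). -/
theorem inv_pow_seven_le_W3 (hδ : 0 < δ) (e : OrthonormalBasis (Fin 3) ℝ E3) {p q : E3} (hpq : δ ≤ ‖p - q‖) :
    (‖p - q‖⁻¹) ^ 7 ≤ (4 / δ) ^ 7 * W3 (gridE δ e p) (gridE δ e q) := by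
  have hρ : 0 < ‖p - q‖ := lt_of_lt_of_le hδ hpq
  have hqp : ‖q - p‖ = ‖p - q‖ := norm_sub_rev _ _
  have hi : ∀ i : Fin 3, 1 + |(((⌊2 / δ * ⟪e i, q⟫⌋ - ⌊2 / δ * ⟪e i, p⟫⌋ : ℤ)) : ℝ)| ≤ 4 / δ * ‖p - q‖ := fun i =>
    one_add_abs_sub_floor_le hδ ((abs_inner_sub_le e q p i).trans hqp.le) hpq
  have hpos : ∀ i : Fin 3, 0 < 1 + |(((⌊2 / δ * ⟪e i, q⟫⌋ - ⌊2 / δ * ⟪e i, p⟫⌋ : ℤ)) : ℝ)| := fun i => by positivity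
  have hfac : ∀ i : Fin 3, ((4 / δ * ‖p - q‖) ^ 2)⁻¹ ≤ bWeight (⌊2 / δ * ⟪e i, q⟫⌋ - ⌊2 / δ * ⟪e i, p⟫⌋) := fun i => by
    unfold bWeight
    push_cast
    have := hi i
    push_cast at this
    have h0 := hpos i
    push_cast at h0
    exact inv_anti₀ (by positivity) (pow_le_pow_left₀ h0.le this 2)
  have hfac3 : ((4 / δ * ‖p - q‖) ^ 3)⁻¹ ≤ cWeight (⌊2 / δ * ⟪e 0, q⟫⌋ - ⌊2 / δ * ⟪e 0, p⟫⌋) := by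
    unfold cWeight
    push_cast
    have := hi 0
    push_cast at this
    have h0 := hpos 0
    push_cast at h0
    exact inv_anti₀ (by positivity) (pow_le_pow_left₀ h0.le this 3)
  have hc : 0 < 4 / δ * ‖p - q‖ := by positivity
  have key : (‖p - q‖⁻¹) ^ 7 =
      (4 / δ) ^ 7 * (((4 / δ * ‖p - q‖) ^ 3)⁻¹ * (((4 / δ * ‖p - q‖) ^ 2)⁻¹ * ((4 / δ * ‖p - q‖) ^ 2)⁻¹)) := by
    field_simp
  rw [key]
  apply mul_le_mul_of_nonneg_left _ (by positivity)
  unfold W3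
  simp only [gridE]
  have hb0 : 0 ≤ ((4 / δ * ‖p - q‖) ^ 2)⁻¹ := by positivity
  exact mul_le_mul hfac3 (mul_le_mul (hfac 1) (hfac 2) hb0 (bWeight_nonneg _)) (mul_nonneg hb0 hb0) (cWeight_nonneg _)

/-- ★ **pair-force domination**: for `‖p − q‖ ≥ δ`, `‖pairForce (p − q)‖ ≤ (δ⁻⁶ + 1)(4/δ)⁷ · W3 (gridE p) (gridE q)`
(`|V'_LJ| ≤ r⁻¹³ + r⁻⁷ ≤ (δ⁻⁶ + 1) r⁻⁷` for `r ≥ δ`). -/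
theorem norm_pairForce_le_W3 (hδ : 0 < δ) (e : OrthonormalBasis (Fin 3) ℝ E3) {p q : E3} (hpq : δ ≤ ‖p - q‖) :
    ‖pairForce (p - q)‖ ≤ ((δ⁻¹) ^ 6 + 1) * (4 / δ) ^ 7 * W3 (gridE δ e p) (gridE δ e q) := by
  have hρ : 0 < ‖p - q‖ := lt_of_lt_of_le hδ hpq
  have hne : p ≠ q := fun h => by
    rw [h, sub_self, norm_zero] at hρ
    exact lt_irrefl _ hρ
  have h1 := norm_pairForce_le hne
  have h6 : (‖p - q‖⁻¹) ^ 6 ≤ (δ⁻¹) ^ 6 := pow_le_pow_left₀ (inv_nonneg.mpr hρ.le) (inv_anti₀ hδ hpq) 6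
  have h13 : (‖p - q‖⁻¹) ^ 13 ≤ (δ⁻¹) ^ 6 * (‖p - q‖⁻¹) ^ 7 := by
    rw [show (13 : ℕ) = 6 + 7 by norm_num, pow_add]
    exact mul_le_mul_of_nonneg_right h6 (pow_nonneg (inv_nonneg.mpr hρ.le) _)
  have h7 := inv_pow_seven_le_W3 hδ e hpq
  calc ‖pairForce (p - q)‖ ≤ (‖p - q‖⁻¹) ^ 13 + (‖p - q‖⁻¹) ^ 7 := h1
    _ ≤ ((δ⁻¹) ^ 6 + 1) * (‖p - q‖⁻¹) ^ 7 := by rw [add_mul, one_mul]; exact add_le_add h13 le_rfl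
    _ ≤ ((δ⁻¹) ^ 6 + 1) * ((4 / δ) ^ 7 * W3 (gridE δ e p) (gridE δ e q)) := mul_le_mul_of_nonneg_left h7 (by positivity)
    _ = ((δ⁻¹) ^ 6 + 1) * (4 / δ) ^ 7 * W3 (gridE δ e p) (gridE δ e q) := by ring

/-- the straddle comparison weight on `(ℕ × ℕ) × (ℤ × ℤ)`: `F ((d,j),(x,y)) = (1+d+j)⁻³ · b x · b y`. -/
def FWeight (y : (ℕ × ℕ) × (ℤ × ℤ)) : ℝ := ((1 + (y.1.1 : ℝ) + y.1.2) ^ 3)⁻¹ * (bWeight y.2.1 * bWeight y.2.2)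

/-- `F ≥ 0`. -/
theorem FWeight_nonneg (y : (ℕ × ℕ) × (ℤ × ℤ)) : 0 ≤ FWeight y :=
  mul_nonneg (inv_cube_add_nonneg _) (mul_nonneg (bWeight_nonneg _) (bWeight_nonneg _))

/-- ★ the straddle comparison weight is summable (`∑ (1+d+j)⁻³ < ∞` times `(∑ b)²`). -/
theorem summable_FWeight : Summable FWeight := by
  have h2 : Summable fun c : ℤ × ℤ => bWeight c.1 * bWeight c.2 :=
    summable_bWeight.mul_of_nonneg summable_bWeight (fun _ => bWeight_nonneg _) (fun _ => bWeight_nonneg _)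
  exact (summable_inv_cube_add.mul_of_nonneg h2 (fun p => inv_cube_add_nonneg p)
    (fun c => mul_nonneg (bWeight_nonneg _) (bWeight_nonneg _))).congr fun y => rfl

end Weight


/-! ## 5. Ball count in a separated set -/

section Count

variable {δ : ℝ} {S : Set E3}

/-- ★ **ball count**: a finite set of atoms of a `δ`-separated set inside `closedBall x R` has at most `(4R/δ + 2)³` elements
(the grid map `…NashForceBalance.grid` injects it into a box of side `≤ 4R/δ + 2`). -/
theorem card_le_of_sep (hδ : 0 < δ) (hS : IsSep δ S) (x : E3) {R : ℝ} (hR : 0 ≤ R) (s : Finset E3)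
    (hs : ∀ q ∈ s, q ∈ S ∧ dist q x ≤ R) : (s.card : ℝ) ≤ (4 * R / δ + 2) ^ 3 := by
  classical
  obtain ⟨L, hL⟩ : ∃ L : Fin 3 → ℤ, L = fun i => ⌊2 / δ * (x.ofLp i - R)⌋ := ⟨_, rfl⟩
  obtain ⟨U, hU⟩ : ∃ U : Fin 3 → ℤ, U = fun i => ⌊2 / δ * (x.ofLp i + R)⌋ := ⟨_, rfl⟩
  have hc : (0 : ℝ) < 2 / δ := by positivity
  have hmaps : Set.MapsTo (grid δ) (s : Set E3)
      (↑(Finset.Icc (L 0) (U 0) ×ˢ (Finset.Icc (L 1) (U 1) ×ˢ Finset.Icc (L 2) (U 2)))) := by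
    intro q hq
    have hq' := hs q hq
    have hqx : ‖q - x‖ ≤ R := by rw [← dist_eq_norm]; exact hq'.2
    have hco : ∀ i : Fin 3, L i ≤ ⌊2 / δ * q.ofLp i⌋ ∧ ⌊2 / δ * q.ofLp i⌋ ≤ U i := by
      intro i
      have h := abs_le.mp ((abs_coord_sub_le_norm q x i).trans hqx)
      rw [hL, hU]
      constructor
      · exact Int.floor_mono (by nlinarith [h.1])
      · exact Int.floor_mono (by nlinarith [h.2])
    simp only [Finset.coe_product, Finset.coe_Icc, Set.mem_prod, Set.mem_Icc, grid]
    exact ⟨hco 0, hco 1, hco 2⟩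
  have hinj : Set.InjOn (grid δ) (s : Set E3) := (grid_injOn hδ hS).mono fun q hq => (hs q (Finset.mem_coe.mp hq)).1
  have hcard := Finset.card_le_card_of_injOn (grid δ) hmaps hinj
  rw [Finset.card_product, Finset.card_product] at hcard
  have hI : ∀ i : Fin 3, ((Finset.Icc (L i) (U i)).card : ℝ) ≤ 4 * R / δ + 2 := by
    intro i
    rw [Int.card_Icc]
    have hLU : L i ≤ U i := by
      rw [hL, hU]
      exact Int.floor_mono (mul_le_mul_of_nonneg_left (by linarith) hc.le)
    have h1 : (((U i + 1 - L i).toNat : ℤ) : ℝ) = (U i : ℝ) + 1 - L i := by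
      rw [Int.toNat_of_nonneg (by omega)]
      push_cast
      ring
    have h2 : ((U i + 1 - L i).toNat : ℝ) = (U i : ℝ) + 1 - L i := by exact_mod_cast h1
    rw [h2]
    have hU1 : (U i : ℝ) ≤ 2 / δ * (x.ofLp i + R) := by rw [hU]; exact Int.floor_le _
    have hL1 : 2 / δ * (x.ofLp i - R) < (L i : ℝ) + 1 := by rw [hL]; exact Int.lt_floor_add_one _
    have h3 : 2 / δ * (x.ofLp i + R) - 2 / δ * (x.ofLp i - R) = 4 * R / δ := by ring
    linarith
  have h0 : (0 : ℝ) ≤ 4 * R / δ + 2 := by positivity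
  have hcard' : (s.card : ℝ) ≤
      ((Finset.Icc (L 0) (U 0)).card : ℝ) * (((Finset.Icc (L 1) (U 1)).card : ℝ) * ((Finset.Icc (L 2) (U 2)).card : ℝ)) := by
    exact_mod_cast hcard
  calc (s.card : ℝ) ≤ ((Finset.Icc (L 0) (U 0)).card : ℝ) * (((Finset.Icc (L 1) (U 1)).card : ℝ) * ((Finset.Icc (L 2) (U 2)).card : ℝ)) :=
        hcard'
    _ ≤ (4 * R / δ + 2) * ((4 * R / δ + 2) * (4 * R / δ + 2)) :=
        mul_le_mul (hI 0) (mul_le_mul (hI 1) (hI 2) (by positivity) h0) (by positivity) h0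
    _ = (4 * R / δ + 2) ^ 3 := by ring

end Count

end Summit.AtomisticToContinuum.Crystallization.Theorems.ChartedPlanarOrderSepCounting

end
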